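import Summits.CriticalPhenomena.PercolationContinuityZ3.Theorems.Transplant.FKConnectivityAllQAntipodalX2WordsTrichotomy
import HarnessLib

/-!
# Connectivity correlation inequalities for `φ_{w,q}` — the TYPE-WORD MODEL of `X2`, file 5: THEOREM A, generic case, validity
# (memo g13 Lemmas 3.2–3.3): the nearest balanced window of RULE N is valid

Helper file (`--supports stmt-CriticalPhenomena-4575`), FK sub-lane `prim-bschramm-fk-2` (gen 13); builds on p205010 (kernel
theorem, internal audit signed; external expert review pending).  Pure finite combinatorics on the type-word model of
`…AntipodalX2Words` (memo `bschramm/FROM-fk-2-g13-WORD-HALL.md`).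
MAIN RESULTS.
* `generic_end_facts`: for a loser with hull `[h, h']` whose hull part has two nonempty rows, the balance flags of RULE N are the
  `headP`/`lastP` comparisons of the two rows of the hull part; an unbalanced left end has `h ≥ 1` and rows starting `(P, ¬P)`, an
  unbalanced right end has `h' + 2 ≤ |x|` and rows ending `(P, ¬P)`.
* `generic_window_valid`: `x = E^s ++ midOf bL bR hp ++ E^b` (the window `[s*, t*]` of RULE N, `midOf` = the hull part extended by
  one ground block at each unbalanced end), the middle rows are nonempty and balanced, and the window swap is a LOSER OF THE SAME
  LEVEL (`balanced_window_valid`).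
* `ruleN_generic`, `iota_generic_eq`, `iota_generic_valid`: RULE N takes the generic branch, `ι x = E^s ++ (midOf …).map swap ++ E^b`,
  and `ι x` is a loser with `level (ι x) = level x`.
The involution property is in the sibling files `…X2WordsPartner`, `…X2WordsInvolution`; the soliton/ground words (memo §4) follow.
[cite: Grimmett2006, §3.9 (p. 63)]
-/

namespace Summit.CriticalPhenomena.PercolationContinuityZ3.Theorems

namespace FK

namespace X2Word

/-! ### Generic validity: the nearest balanced window is valid (memo g13 Lemmas 3.2–3.3) -/

section Generic

variable {k₀ : Kind} {x : List Ty} {h h' : ℕ}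

/-- The middle word of the nearest balanced window: the hull part, extended by one ground block at each unbalanced end. [folklore] -/
def midOf (bL bR : Bool) (hp : List Ty) : List Ty := (if bL then [] else [.E]) ++ hp ++ (if bR then [] else [.E])

/-- Row `A` of `midOf`. [folklore] -/
theorem rowA_midOf (ks : Kind) (bL bR : Bool) (hp : List Ty) :
    rowA ks (midOf bL bR hp) =
      (if bL then [] else rowA ks [.E]) ++ rowA (if bL then ks else ks.other) hp ++
        (if bR then [] else rowA (kindAt (if bL then ks else ks.other) hp.length) [.E]) := by
  unfold midOf
  cases bL <;> cases bR <;> simp [rowA_cons, rowA_append, kindAt]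

/-- Row `B` of `midOf`. [folklore] -/
theorem rowB_midOf (ks : Kind) (bL bR : Bool) (hp : List Ty) :
    rowB ks (midOf bL bR hp) =
      (if bL then [] else rowB ks [.E]) ++ rowB (if bL then ks else ks.other) hp ++
        (if bR then [] else rowB (kindAt (if bL then ks else ks.other) hp.length) [.E]) := by
  unfold midOf
  cases bL <;> cases bR <;> simp [rowB_cons, rowB_append, kindAt]

/-- `headP` of a `cons`. [folklore] -/
theorem headP_cons (a : Kind) (l : List Kind) : headP (a :: l) = decide (a = .P) := by
  cases a <;> rfl

/-- `lastP` of a `snoc`. [folklore] -/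
theorem lastP_concat (l : List Kind) (a : Kind) : lastP (l ++ [a]) = decide (a = .P) := by
  cases a <;> simp [lastP]

/-- `lastP` of a singleton. [folklore] -/
theorem lastP_singleton (a : Kind) : lastP [a] = decide (a = .P) := by
  cases a <;> rfl

/-- The rows of `midOf`: nonempty and BALANCED at both ends, given the facts of memo g13 Lemma 3.3 about the hull part. [folklore] -/
theorem midOf_rows (ks k : Kind) (bL bR : Bool) (hp : List Ty) (hkk : (if bL then ks else ks.other) = k)
    (hA : rowA k hp ≠ []) (hB : rowB k hp ≠ [])
    (hLf : bL = false → headP (rowA k hp) = true ∧ headP (rowB k hp) = false)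
    (hLt : bL = true → headP (rowA k hp) = headP (rowB k hp))
    (hRf : bR = false → lastP (rowA k hp) = true ∧ lastP (rowB k hp) = false)
    (hRt : bR = true → lastP (rowA k hp) = lastP (rowB k hp)) :
    rowA ks (midOf bL bR hp) ≠ [] ∧ rowB ks (midOf bL bR hp) ≠ [] ∧
      headP (rowA ks (midOf bL bR hp)) = headP (rowB ks (midOf bL bR hp)) ∧
        lastP (rowA ks (midOf bL bR hp)) = lastP (rowB ks (midOf bL bR hp)) := by
  rw [rowA_midOf, rowB_midOf, hkk]
  generalize kindAt k hp.length = ke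
  refine ⟨by cases bL <;> cases bR <;> simp [hA], by cases bL <;> cases bR <;> simp [hB], ?_, ?_⟩
  · cases bL with
    | true =>
      have e := hLt rfl
      simp only [if_true, List.nil_append, headP_append, if_neg hA, if_neg hB, e]
    | false =>
      obtain ⟨h1, h2⟩ := hLf rfl
      have hks : ks = k.other := by rw [← hkk]; simp
      subst hks
      cases k <;>
        simp [rowA_singleton, rowB_singleton, visA, visB, headP_append, hA, hB, h1, h2, headP_cons]
  · cases bR with
    | true =>
      have e := hRt rfl
      simp only [if_true, List.append_nil, lastP_append, if_neg hA, if_neg hB, e]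
    | false =>
      obtain ⟨h1, h2⟩ := hRf rfl
      cases ke <;> cases bL <;>
        simp [rowA_singleton, rowB_singleton, visA, visB, lastP_append, hA, hB, h1, h2, lastP_singleton]

/-- The hull part, as a variable: length, nonempty, first and last block not ground. [folklore] -/
theorem hullPart_spec' (hs : hullStart x = some h) (he : hullEnd x = some h') {hp : List Ty}
    (hhp : hp = (x.drop h).take (h' + 1 - h)) :
    hp.length = h' + 1 - h ∧ hp ≠ [] ∧ (∀ e l, hp = e :: l → e ≠ .E) ∧ (∀ l e, hp = l ++ [e] → e ≠ .E) := by
  obtain ⟨hlen, h0, hfirst, hlast⟩ := hullPart_spec hs he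
  rw [← hhp] at hlen
  refine ⟨hlen, List.ne_nil_of_length_pos (by rw [← hhp] at h0; exact h0), ?_, ?_⟩
  · rintro e l hel
    have : hp[0]'(by rw [hel]; simp) = e := by simp [hel]
    rw [← this]; subst hhp; exact hfirst
  · rintro l e hel
    have h1 : hp.length - 1 < hp.length := by rw [hel]; simp
    have : hp[hp.length - 1]'h1 = e := by simp [hel]
    rw [← this]; subst hhp; exact hlast

/-- **The end facts of a generic loser (memo g13 Lemma 3.3).**  For a loser `x` with hull `[h, h']` and hull part `hp` with two
nonempty rows: the balance flags of RULE N are the comparisons of `headP`/`lastP` of the two rows of `hp`; an UNBALANCED left end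
has `h ≥ 1` and rows starting `(P, ¬P)`; an unbalanced right end has `h' + 2 ≤ |x|` and rows ending `(P, ¬P)`; and
`x = E^h ++ hp ++ E^(|x|-1-h')`. [folklore] -/
theorem generic_end_facts (hx : isLoser k₀ x = true) (hs : hullStart x = some h) (he : hullEnd x = some h')
    {hp : List Ty} (hhp : hp = (x.drop h).take (h' + 1 - h))
    (hA : rowA (kindAt k₀ h) hp ≠ []) (hB : rowB (kindAt k₀ h) hp ≠ []) :
    x = List.replicate h .E ++ hp ++ List.replicate (x.length - 1 - h') .E ∧ hp.length = h' + 1 - h ∧ h ≤ h' ∧ h' < x.length ∧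
    balancedL k₀ x h = (headP (rowA (kindAt k₀ h) hp) == headP (rowB (kindAt k₀ h) hp)) ∧
    balancedR k₀ x h' = (lastP (rowA (kindAt k₀ h) hp) == lastP (rowB (kindAt k₀ h) hp)) ∧
    (balancedL k₀ x h = false →
      1 ≤ h ∧ headP (rowA (kindAt k₀ h) hp) = true ∧ headP (rowB (kindAt k₀ h) hp) = false) ∧
    (balancedR k₀ x h' = false →
      h' + 2 ≤ x.length ∧ lastP (rowA (kindAt k₀ h) hp) = true ∧ lastP (rowB (kindAt k₀ h) hp) = false) := by
  obtain ⟨hle, hh', hxd⟩ := hull_decomp hs he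
  obtain ⟨hlen, hne, hcons, hsnoc⟩ := hullPart_spec' hs he hhp
  rw [← hhp] at hxd
  generalize hk : kindAt k₀ h = k at hA hB ⊢
  set nb := x.length - 1 - h' with hnb
  -- the balance flags, read off the hull part
  have hbL : balancedL k₀ x h = (headP (rowA k hp) == headP (rowB k hp)) := by
    unfold balancedL
    rw [firstA_eq hs he (hhp ▸ hk ▸ hA), firstB_eq hs he (hhp ▸ hk ▸ hB), ← hhp, hk]
    unfold headP
    rcases (rowA k hp).head? with _ | a <;> rcases (rowB k hp).head? with _ | b <;> (try cases a) <;> (try cases b) <;> rfl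
  have hbR : balancedR k₀ x h' = (lastP (rowA k hp) == lastP (rowB k hp)) := by
    unfold balancedR
    rw [lastA_eq hs he (hhp ▸ hk ▸ hA), lastB_eq hs he (hhp ▸ hk ▸ hB), ← hhp, hk]
    unfold lastP
    rcases (rowA k hp).getLast? with _ | a <;> rcases (rowB k hp).getLast? with _ | b <;> (try cases a) <;>
      (try cases b) <;> rfl
  -- rows of `x` itself
  have hrowA : rowA k₀ x = rowA k₀ (List.replicate h .E) ++ rowA k hp ++ rowA (kindAt k₀ (h + hp.length)) (List.replicate nb .E) := by
    conv_lhs => rw [hxd]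
    rw [rowA_decomp, hk]
  have hrowB : rowB k₀ x = rowB k₀ (List.replicate h .E) ++ rowB k hp ++ rowB (kindAt k₀ (h + hp.length)) (List.replicate nb .E) := by
    conv_lhs => rw [hxd]
    rw [rowB_decomp, hk]
  refine ⟨hxd, hlen, hle, hh', hbL, hbR, ?_, ?_⟩
  · -- LEFT END (memo 3.3): unbalanced ⇒ (P, not-P) and h ≥ 1
    intro hb
    have hunb : headP (rowA k hp) ≠ headP (rowB k hp) := by
      intro heq; rw [hbL, heq] at hb; simp at hb
    obtain ⟨e, l, hel⟩ := List.exists_cons_of_ne_nil hne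
    have he' := hcons e l hel
    rw [hel] at hunb
    obtain ⟨h1, h2⟩ := unbalanced_head k he' l hunb
    rw [← hel] at h1 h2
    refine ⟨?_, h1, h2⟩
    by_contra hh0
    have h0 : h = 0 := by omega
    have : headP (rowA k₀ x) = true := by
      rw [hrowA, h0, List.replicate_zero, rowA_nil, List.nil_append, headP_append, if_neg hA, h1]
    simp [isLoser, this] at hx
  · -- RIGHT END: unbalanced ⇒ (P, not-P) and a ground block after the hull
    intro hb
    have hunb : lastP (rowA k hp) ≠ lastP (rowB k hp) := by
      intro heq; rw [hbR, heq] at hb; simp at hb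
    obtain ⟨l, e, hel⟩ : ∃ l e, hp = l ++ [e] := by
      rcases List.eq_nil_or_concat hp with h0 | ⟨l, e, hel⟩
      · exact absurd h0 hne
      · exact ⟨l, e, by rw [hel, List.concat_eq_append]⟩
    have he' := hsnoc l e hel
    rw [hel] at hunb
    obtain ⟨h1, h2⟩ := unbalanced_last k l he' hunb
    rw [← hel] at h1 h2
    refine ⟨?_, h1, h2⟩
    by_contra hh0
    have h0 : nb = 0 := by omega
    have : lastP (rowB k₀ x) = false := by
      rw [hrowB, h0, List.replicate_zero, rowB_nil, List.append_nil, lastP_append, if_neg hB, h2]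
    simp [isLoser, this] at hx

/-- **Generic validity (memo g13 Lemmas 3.2–3.3).**  Let `x` be a loser with hull `[h, h']` and hull part `hp` whose two rows are
nonempty (`x` is "generic": neither a soliton word nor ground), and let `bL = balancedL k₀ x h`, `bR = balancedR k₀ x h'`.  Then
`x = E^s ++ midOf bL bR hp ++ E^b` with `s = h` or `h - 1` and the matching `b` (this middle is the window `[s*, t*]` of RULE N), the
two rows of the middle are nonempty and balanced, and the window swap `E^s ++ (midOf bL bR hp).map swap ++ E^b` is a LOSER OF THE
SAME LEVEL. [folklore] -/
theorem generic_window_valid (hx : isLoser k₀ x = true) (hs : hullStart x = some h) (he : hullEnd x = some h')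
    {hp : List Ty} (hhp : hp = (x.drop h).take (h' + 1 - h))
    (hA : rowA (kindAt k₀ h) hp ≠ []) (hB : rowB (kindAt k₀ h) hp ≠ []) :
    (balancedL k₀ x h = false → 1 ≤ h) ∧ (balancedR k₀ x h' = false → h' + 2 ≤ x.length) ∧
    x = List.replicate (if balancedL k₀ x h then h else h - 1) .E ++ midOf (balancedL k₀ x h) (balancedR k₀ x h') hp ++
          List.replicate (if balancedR k₀ x h' then x.length - 1 - h' else x.length - 2 - h') .E ∧
    (rowA (kindAt k₀ (if balancedL k₀ x h then h else h - 1)) (midOf (balancedL k₀ x h) (balancedR k₀ x h') hp) ≠ [] ∧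
      rowB (kindAt k₀ (if balancedL k₀ x h then h else h - 1)) (midOf (balancedL k₀ x h) (balancedR k₀ x h') hp) ≠ [] ∧
      headP (rowA (kindAt k₀ (if balancedL k₀ x h then h else h - 1)) (midOf (balancedL k₀ x h) (balancedR k₀ x h') hp)) =
        headP (rowB (kindAt k₀ (if balancedL k₀ x h then h else h - 1)) (midOf (balancedL k₀ x h) (balancedR k₀ x h') hp)) ∧
      lastP (rowA (kindAt k₀ (if balancedL k₀ x h then h else h - 1)) (midOf (balancedL k₀ x h) (balancedR k₀ x h') hp)) =
        lastP (rowB (kindAt k₀ (if balancedL k₀ x h then h else h - 1)) (midOf (balancedL k₀ x h) (balancedR k₀ x h') hp))) ∧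
    isLoser k₀ (List.replicate (if balancedL k₀ x h then h else h - 1) .E ++
        (midOf (balancedL k₀ x h) (balancedR k₀ x h') hp).map Ty.swap ++
          List.replicate (if balancedR k₀ x h' then x.length - 1 - h' else x.length - 2 - h') .E) = true ∧
    level k₀ (List.replicate (if balancedL k₀ x h then h else h - 1) .E ++
        (midOf (balancedL k₀ x h) (balancedR k₀ x h') hp).map Ty.swap ++
          List.replicate (if balancedR k₀ x h' then x.length - 1 - h' else x.length - 2 - h') .E) = level k₀ x := by
  obtain ⟨hxd, hlen, hle, hh', hbL, hbR, hL, hR⟩ := generic_end_facts hx hs he hhp hA hB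
  generalize hk : kindAt k₀ h = k at hA hB hbL hbR hL hR
  refine ⟨fun hb => (hL hb).1, fun hb => (hR hb).1, ?_⟩
  -- the decomposition of `x` around the window
  have eL : List.replicate h Ty.E =
      List.replicate (if balancedL k₀ x h then h else h - 1) .E ++ (if balancedL k₀ x h then [] else [.E]) := by
    cases hb : balancedL k₀ x h
    · have h1 := (hL hb).1
      simp only [Bool.false_eq_true, if_false]
      rw [← List.replicate_succ']
      congr 1; omega
    · simp
  have eR : List.replicate (x.length - 1 - h') Ty.E = (if balancedR k₀ x h' then [] else [.E]) ++
      List.replicate (if balancedR k₀ x h' then x.length - 1 - h' else x.length - 2 - h') .E := by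
    cases hb : balancedR k₀ x h'
    · have h1 := (hR hb).1
      simp only [Bool.false_eq_true, if_false, List.singleton_append, ← List.replicate_succ]
      congr 1; omega
    · simp
  have hX : x = List.replicate (if balancedL k₀ x h then h else h - 1) .E ++
      midOf (balancedL k₀ x h) (balancedR k₀ x h') hp ++
        List.replicate (if balancedR k₀ x h' then x.length - 1 - h' else x.length - 2 - h') .E := by
    calc x = _ := hxd
      _ = _ := by rw [eL, eR]; simp only [midOf, List.append_assoc]
  refine ⟨hX, ?_⟩
  -- the middle rows: nonempty and balanced (Lemma 3.3), then Lemma 3.2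
  have hkk : (if balancedL k₀ x h then kindAt k₀ (if balancedL k₀ x h then h else h - 1)
      else (kindAt k₀ (if balancedL k₀ x h then h else h - 1)).other) = k := by
    cases hb : balancedL k₀ x h
    · have h1 := (hL hb).1
      simp only [Bool.false_eq_true, if_false]
      rw [kindAt_pred h1, hk, Kind.other_other]
    · simp [hk]
  have hLt : balancedL k₀ x h = true → headP (rowA k hp) = headP (rowB k hp) := by
    intro hb; rw [hbL] at hb
    revert hb
    cases headP (rowA k hp) <;> cases headP (rowB k hp) <;> decide
  have hRt : balancedR k₀ x h' = true → lastP (rowA k hp) = lastP (rowB k hp) := by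
    intro hb; rw [hbR] at hb
    revert hb
    cases lastP (rowA k hp) <;> cases lastP (rowB k hp) <;> decide
  obtain ⟨hA', hB', hhead, hlast⟩ := midOf_rows _ k (balancedL k₀ x h) (balancedR k₀ x h') hp hkk hA hB
    (fun hb => (hL hb).2) hLt (fun hb => (hR hb).2) hRt
  refine ⟨⟨hA', hB', hhead, hlast⟩, ?_⟩
  have hx' := hx
  rw [hX] at hx'
  obtain ⟨h1, h2⟩ := balanced_window_valid k₀ _ _ (midOf (balancedL k₀ x h) (balancedR k₀ x h') hp) hA' hB' hhead hlast hx'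
  exact ⟨h1, by rw [h2, ← hX]⟩

/-- RULE N on a generic word: the window is `[s*, t*]` of memo g13 §2 (G). [folklore] -/
theorem ruleN_generic (hs : hullStart x = some h) (he : hullEnd x = some h')
    (hsol : isSoliton k₀ x (kindAt k₀ h) h ((h' - h) / 2) = false) :
    ruleN k₀ x = some (if balancedL k₀ x h then h else h - 1, if balancedR k₀ x h' then h' else h' + 1) := by
  unfold ruleN
  rw [hs, he]
  simp [hsol]

/-- Length of `midOf`. [folklore] -/
theorem length_midOf (bL bR : Bool) (hp : List Ty) :
    (midOf bL bR hp).length = (if bL then 0 else 1) + hp.length + (if bR then 0 else 1) := by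
  unfold midOf; cases bL <;> cases bR <;> simp <;> omega

/-- The partner of a generic word, explicitly: `ι x = E^s ++ (midOf bL bR hp).map swap ++ E^b`. [folklore] -/
theorem iota_generic_eq (hx : isLoser k₀ x = true) (hs : hullStart x = some h) (he : hullEnd x = some h')
    {hp : List Ty} (hhp : hp = (x.drop h).take (h' + 1 - h))
    (hA : rowA (kindAt k₀ h) hp ≠ []) (hB : rowB (kindAt k₀ h) hp ≠ []) :
    iota k₀ x = List.replicate (if balancedL k₀ x h then h else h - 1) .E ++
      (midOf (balancedL k₀ x h) (balancedR k₀ x h') hp).map Ty.swap ++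
        List.replicate (if balancedR k₀ x h' then x.length - 1 - h' else x.length - 2 - h') .E := by
  obtain ⟨hL, hR, hX, -, -, -⟩ := generic_window_valid hx hs he hhp hA hB
  obtain ⟨hle, hh', -⟩ := hull_decomp hs he
  have hlen : hp.length = h' + 1 - h := (hullPart_spec' hs he hhp).1
  have hsol := isSoliton_false_of_rows_ne_nil' hs he hhp hA hB
  generalize hbl : balancedL k₀ x h = bL at hX hL
  generalize hbr : balancedR k₀ x h' = bR at hX hR
  unfold iota
  rw [ruleN_generic hs he hsol, hbl, hbr]
  simp only
  have hmid : midOf bL bR hp ≠ [] := by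
    rw [Ne, ← List.length_eq_zero_iff, length_midOf, hlen]; omega
  have key := swapWin_append (List.replicate (if bL then h else h - 1) .E) (midOf bL bR hp)
    (List.replicate (if bR then x.length - 1 - h' else x.length - 2 - h') .E) hmid
  rw [← hX, List.length_replicate, length_midOf, hlen] at key
  have eidx : (if bL then h else h - 1) + ((if bL then 0 else 1) + (h' + 1 - h) + (if bR then 0 else 1)) - 1 =
      (if bR then h' else h' + 1) := by
    cases bL <;> cases bR <;> simp at hL hR ⊢ <;> omega
  rw [eidx] at key
  exact key

/-- **Theorem A, generic case, validity half (memo g13 §3):** for a loser `x` that is neither ground nor a soliton word (its hull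
part has two nonempty rows), the partner `ι x` given by RULE N — the `E ↔ F` swap on the nearest balanced window — is again a
loser, of the same level. [folklore] -/
theorem iota_generic_valid (hx : isLoser k₀ x = true) (hs : hullStart x = some h) (he : hullEnd x = some h')
    (hA : rowA (kindAt k₀ h) ((x.drop h).take (h' + 1 - h)) ≠ [])
    (hB : rowB (kindAt k₀ h) ((x.drop h).take (h' + 1 - h)) ≠ []) :
    isLoser k₀ (iota k₀ x) = true ∧ level k₀ (iota k₀ x) = level k₀ x := by
  obtain ⟨-, -, -, -, hlos, hlev⟩ := generic_window_valid hx hs he rfl hA hB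
  rw [iota_generic_eq hx hs he rfl hA hB]
  exact ⟨hlos, hlev⟩

end Generic

end X2Word

end FK

end Summit.CriticalPhenomena.PercolationContinuityZ3.Theorems
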